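/-
Copyright: rh-split cell (nb, neg) gen 17, 2026-08-27.  Splitting search over kernel-typed
RH-equivalences.  A splitting `A ∧ B ⟹ RH` is CONDITIONAL bookkeeping unless `A` and `B` are both
proved; nothing here bears on the truth of RH.
-/
import Summits.RiemannHypothesis.RiemannHypothesis.Theorems.Splittings.NbOneShotB
import HarnessLib

/-!
# One-shot Nyman–Beurling certificates are decided RH-free (nb/neg V42) — part C

Continuation of `NbOneShotB` (same namespace `…Splittings.NbOneShot`; the module docstring of
`NbOneShotA` states the objects, the census row and the theorem map for all parts).  Content below is the
original one-file kernel VERBATIM (lines 620–786 of the uncarved file).  No `sorry`, no new axioms, no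
definitions, no instances, no notation.
-/

noncomputable section

set_option linter.dupNamespace false
open Complex Filter Topology Metric LSeries

namespace Summit.RiemannHypothesis.RiemannHypothesis.Theorems.Splittings.NbOneShot

open Summit.RiemannHypothesis.RiemannHypothesis.Theses.NymanBeurling
open Summit.RiemannHypothesis.RiemannHypothesis.Theorems
open Literature.NumberTheory.LFunctions
open Literature.Barriers.RiemannHypothesis

/-! ## §3 — The census row V42: one-shot certificates -/

/-- **K1 (bookkeeping): a one-shot certificate on `σ₀ < Re s < 1` implies the quasi-Riemann
hypothesis `QuasiRiemannHypothesis σ₀`** (no zero of `ζ` with `σ₀ < Re s < 1`): at a zero the defect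
is `‖1 - 0‖ = 1`, not `< 1`. [folklore] -/
theorem qrh_of_oneShot {σ₀ : ℝ}
    (h : ∃ (N : ℕ) (a : Fin N → ℂ), ∀ s : ℂ, σ₀ < s.re → s.re < 1 →
      ‖1 - riemannZeta s * ∑ n : Fin N, a n * ((n : ℂ) + 1) ^ (-s)‖ < 1) :
    QuasiRiemannHypothesis σ₀ := by
  obtain ⟨N, a, h⟩ := h
  intro s hz h1 h2
  have h3 := h s h1 h2
  rw [hz, zero_mul, sub_zero, norm_one] at h3
  exact lt_irrefl _ h3

/-- **K1 at `σ₀ = 1/2`: a one-shot certificate on the critical strip implies RH** (the symmetry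
`s ↦ 1 - s` of the non-trivial zeros, tree `quasiRiemannHypothesis_one_half_iff_holds`). [folklore] -/
theorem rh_of_oneShot
    (h : ∃ (N : ℕ) (a : Fin N → ℂ), ∀ s : ℂ, 1 / 2 < s.re → s.re < 1 →
      ‖1 - riemannZeta s * ∑ n : Fin N, a n * ((n : ℂ) + 1) ^ (-s)‖ < 1) :
    _root_.RiemannHypothesis :=
  quasiRiemannHypothesis_one_half_iff_holds.1 (qrh_of_oneShot h)

/-- K1 in the route's currency: a one-shot certificate on the critical strip implies
`E_NB = NbThesis` (through RH and the landed deep half `nbThesis_iff_riemannHypothesis`).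
[BaezDuarte2003, Thm. 1.1] -/
theorem nbThesis_of_oneShot
    (h : ∃ (N : ℕ) (a : Fin N → ℂ), ∀ s : ℂ, 1 / 2 < s.re → s.re < 1 →
      ‖1 - riemannZeta s * ∑ n : Fin N, a n * ((n : ℂ) + 1) ^ (-s)‖ < 1) :
    NbThesis :=
  nbThesis_iff_riemannHypothesis.mpr (rh_of_oneShot h)

/-- **K1-far (bookkeeping): a one-shot certificate on the FAR strip `σ₀ < Re s < 1`, `Im s ≥ T`
confines the zeros of `ζ` with `σ₀ < Re s < 1` below height `T`** (a cofinite quasi-Riemann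
hypothesis). [folklore] -/
theorem zerosBelow_of_oneShotFar {σ₀ T : ℝ}
    (h : ∃ (N : ℕ) (a : Fin N → ℂ), ∀ s : ℂ, σ₀ < s.re → s.re < 1 → T ≤ s.im →
      ‖1 - riemannZeta s * ∑ n : Fin N, a n * ((n : ℂ) + 1) ^ (-s)‖ < 1) :
    ∀ s : ℂ, riemannZeta s = 0 → σ₀ < s.re → s.re < 1 → s.im < T := by
  obtain ⟨N, a, h⟩ := h
  intro s hz h1 h2
  by_contra hT
  push Not at hT
  have h3 := h s h1 h2 hT
  rw [hz, zero_mul, sub_zero, norm_one] at h3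
  exact lt_irrefl _ h3

/-- **The far one-shot certificate is decided RH-free by its tolerance (nb/neg V42): for every
`σ₀ < 1`, every height `T` and every `θ`, «some Dirichlet polynomial `A` has `‖1 - ζ(s)A(s)‖ < θ`
throughout `σ₀ < Re s < 1`, `Im s ≥ T`» holds IFF `θ > 1`.**  (`⇐`: the EMPTY polynomial `A = 0`
has defect `≡ 1`.  `⇒`: if `a = 0` the defect at `σ₁ + iT` is `1 < θ`; if `a ≠ 0` the defect is
unbounded on the far part of the closed sub-strip `[(2μ+1)/3, (μ+2)/3]`, `μ = max(σ₀, 1/2)` —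
mollified universality, `exists_lt_norm_one_sub_zeta_mul` — contradiction.)  So the whole
RH-content of `E_NB` sits in its `∀ ε ∃ (N,a)` quantifier and its `L²(dt/(1/4+t²))` averaging: every
sup-norm single-witness version, even far up the strip, is settled without RH, and only the vacuous
witness `A = 0` ever certifies anything. [cite: Steuding2007, Thm. 1.9] -/
theorem oneShotFar_iff_one_lt {σ₀ : ℝ} (hσ₀ : σ₀ < 1) (T θ : ℝ) :
    (∃ (N : ℕ) (a : Fin N → ℂ), ∀ s : ℂ, σ₀ < s.re → s.re < 1 → T ≤ s.im →
      ‖1 - riemannZeta s * ∑ n : Fin N, a n * ((n : ℂ) + 1) ^ (-s)‖ < θ) ↔ 1 < θ := by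
  set μ : ℝ := max σ₀ (1 / 2) with hμ
  have hμ₀ : σ₀ ≤ μ := le_max_left _ _
  have hμh : 1 / 2 ≤ μ := le_max_right _ _
  have hμ1 : μ < 1 := max_lt hσ₀ (by norm_num)
  set σ₁ : ℝ := (2 * μ + 1) / 3 with hσ₁
  set σ₂ : ℝ := (μ + 2) / 3 with hσ₂
  have h₁ : 1 / 2 < σ₁ := by rw [hσ₁]; linarith
  have h₀₁ : σ₀ < σ₁ := by rw [hσ₁]; linarith
  have h₁₂ : σ₁ < σ₂ := by rw [hσ₁, hσ₂]; linarith
  have h₂ : σ₂ < 1 := by rw [hσ₂]; linarith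
  constructor
  · rintro ⟨N, a, h⟩
    by_cases ha : a = 0
    · have h3 := h (((σ₁ : ℝ) : ℂ) + T * I) (by simpa using h₀₁) (by simpa using h₁₂.trans h₂)
        (by simp)
      subst ha
      simpa using h3
    · obtain ⟨s, hs₁, hs₂, hs₃, h3⟩ := exists_lt_norm_one_sub_zeta_mul ha h₁ h₁₂ h₂ θ T
      have h4 := h s (by linarith) (by linarith) hs₃
      linarith
  · intro hθ
    refine ⟨0, fun _ => 0, fun s _ _ _ => ?_⟩
    simpa using hθ

/-- K2-far: no one-shot certificate on any far strip `σ₀ < Re s < 1`, `Im s ≥ T` (`σ₀ < 1`); the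
case `θ = 1` of `oneShotFar_iff_one_lt`.  RH-free. [cite: Steuding2007, Thm. 1.9] -/
theorem not_oneShotFar {σ₀ : ℝ} (hσ₀ : σ₀ < 1) (T : ℝ) :
    ¬ ∃ (N : ℕ) (a : Fin N → ℂ), ∀ s : ℂ, σ₀ < s.re → s.re < 1 → T ≤ s.im →
      ‖1 - riemannZeta s * ∑ n : Fin N, a n * ((n : ℂ) + 1) ^ (-s)‖ < 1 :=
  fun h => lt_irrefl _ ((oneShotFar_iff_one_lt hσ₀ T 1).mp h)

/-- **The one-shot certificate on the whole strip `σ₀ < Re s < 1` is decided RH-free by its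
tolerance: it exists IFF `θ > 1`** (from the far version with `T = 0`; `⇐` by `A = 0`).
[cite: Steuding2007, Thm. 1.9] -/
theorem oneShot_iff_one_lt {σ₀ : ℝ} (hσ₀ : σ₀ < 1) (θ : ℝ) :
    (∃ (N : ℕ) (a : Fin N → ℂ), ∀ s : ℂ, σ₀ < s.re → s.re < 1 →
      ‖1 - riemannZeta s * ∑ n : Fin N, a n * ((n : ℂ) + 1) ^ (-s)‖ < θ) ↔ 1 < θ := by
  constructor
  · rintro ⟨N, a, h⟩
    exact (oneShotFar_iff_one_lt hσ₀ 0 θ).mp ⟨N, a, fun s h1 h2 _ => h s h1 h2⟩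
  · intro hθ
    refine ⟨0, fun _ => 0, fun s _ _ => ?_⟩
    simpa using hθ

/-- **K2 (nb/neg V42 refuted, RH-FREE, for EVERY `σ₀ < 1`): there is NO one-shot certificate on any
strip `σ₀ < Re s < 1`** — the case `θ = 1` of `oneShot_iff_one_lt`.  No zero of `ζ` and no zero-free
region is used: a pointwise single-witness certificate cannot certify ANY zero-free strip, however
thin. [cite: Steuding2007, Thm. 1.9] -/
theorem not_oneShot {σ₀ : ℝ} (hσ₀ : σ₀ < 1) :
    ¬ ∃ (N : ℕ) (a : Fin N → ℂ), ∀ s : ℂ, σ₀ < s.re → s.re < 1 →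
      ‖1 - riemannZeta s * ∑ n : Fin N, a n * ((n : ℂ) + 1) ^ (-s)‖ < 1 :=
  fun h => lt_irrefl _ ((oneShot_iff_one_lt hσ₀ 1).mp h)

/-- K2 at `σ₀ = 1/2` (the critical strip): no Dirichlet polynomial has `‖1 - ζ(s)A(s)‖ < 1` throughout
`1/2 < Re s < 1`.  RH-free. [cite: Steuding2007, Thm. 1.9] -/
theorem not_oneShot_half :
    ¬ ∃ (N : ℕ) (a : Fin N → ℂ), ∀ s : ℂ, 1 / 2 < s.re → s.re < 1 →
      ‖1 - riemannZeta s * ∑ n : Fin N, a n * ((n : ℂ) + 1) ^ (-s)‖ < 1 :=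
  not_oneShot (by norm_num)

/-- **Polarisation of the one-shot splitting (logic).**  For every `σ₀ < 1`: «ONE-SHOT(σ₀) ∧ B ⟹
QRH(σ₀)» holds for EVERY conjunct `B` (K1) while ONE-SHOT(σ₀) is refuted (K2) — the scheme is vacuous
bookkeeping, never a splitting. [folklore] -/
theorem oneShot_split_vacuous {σ₀ : ℝ} (hσ₀ : σ₀ < 1) (B : Prop) :
    (((∃ (N : ℕ) (a : Fin N → ℂ), ∀ s : ℂ, σ₀ < s.re → s.re < 1 →
        ‖1 - riemannZeta s * ∑ n : Fin N, a n * ((n : ℂ) + 1) ^ (-s)‖ < 1) ∧ B) →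
      QuasiRiemannHypothesis σ₀) ∧
    ¬ (∃ (N : ℕ) (a : Fin N → ℂ), ∀ s : ℂ, σ₀ < s.re → s.re < 1 →
        ‖1 - riemannZeta s * ∑ n : Fin N, a n * ((n : ℂ) + 1) ^ (-s)‖ < 1) :=
  ⟨fun h => qrh_of_oneShot h.1, not_oneShot hσ₀⟩

/-- The same at `σ₀ = 1/2` with RH as the conclusion: «ONE-SHOT(1/2) ∧ B ⟹ RH» for every `B`, and
¬ONE-SHOT(1/2). [folklore] -/
theorem oneShot_split_vacuous_rh (B : Prop) :
    (((∃ (N : ℕ) (a : Fin N → ℂ), ∀ s : ℂ, 1 / 2 < s.re → s.re < 1 →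
        ‖1 - riemannZeta s * ∑ n : Fin N, a n * ((n : ℂ) + 1) ^ (-s)‖ < 1) ∧ B) →
      _root_.RiemannHypothesis) ∧
    ¬ (∃ (N : ℕ) (a : Fin N → ℂ), ∀ s : ℂ, 1 / 2 < s.re → s.re < 1 →
        ‖1 - riemannZeta s * ∑ n : Fin N, a n * ((n : ℂ) + 1) ^ (-s)‖ < 1) :=
  ⟨fun h => rh_of_oneShot h.1, not_oneShot_half⟩

/-- **K4 (the critical-line one-shot is refuted by ONE certified zero).**  `E_NB`'s integrand
pointwise: no Dirichlet polynomial has `‖1 - ζ(1/2+it)·A(1/2+it)‖ < 1` for ALL real `t`, because at the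
certified critical zero `γ₁ ∈ [225/16, 227/16]` (tree `exists_zero_Icc_first_bracket`, a
`decide +kernel` argument-principle certificate) the defect equals `1` whatever `A` is.
[cite: Edwards1974, §6.6] -/
theorem not_oneShot_criticalLine :
    ¬ ∃ (N : ℕ) (a : Fin N → ℂ), ∀ t : ℝ,
      ‖1 - riemannZeta (1 / 2 + t * I) *
        ∑ n : Fin N, a n * ((n : ℂ) + 1) ^ (-(1 / 2 + t * I))‖ < 1 := by
  rintro ⟨N, a, h⟩
  obtain ⟨γ, -, hγ⟩ := exists_zero_Icc_first_bracket
  have h3 := h γ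
  rw [hγ, zero_mul, sub_zero, norm_one] at h3
  exact lt_irrefl _ h3

/-- At a critical zero the Nyman–Beurling defect is pinned to `1`, for EVERY mollifier: with
`ζ(1/2+iγ) = 0`, `‖1 - ζ(1/2+iγ)A(1/2+iγ)‖ = 1` — the pointwise obstruction behind K4 (and behind the
zero-driven lower bounds for `d_N`). [folklore] -/
theorem nbDefect_eq_one_of_zero {γ : ℝ} (hγ : riemannZeta (1 / 2 + γ * I) = 0) {N : ℕ}
    (a : Fin N → ℂ) :
    ‖1 - riemannZeta (1 / 2 + γ * I) *
        ∑ n : Fin N, a n * ((n : ℂ) + 1) ^ (-(1 / 2 + γ * I))‖ = 1 := by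
  rw [hγ, zero_mul, sub_zero, norm_one]

end Summit.RiemannHypothesis.RiemannHypothesis.Theorems.Splittings.NbOneShot

end
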